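import Mathlib
import Literature.NumberTheory.Automorphic.HilbertModularFormQExpansion

/-!
# Crux `HilbertIntegralOverconvergentIsCongruence` (stmt-Langlands-8485), line `Sketch-ideate-r1-k1`, RESHAPE 16 (§ T):
# registered stub T7 `stub_enc_monomial`

Encodings of monomials in Hilbert modular forms.
-/

set_option linter.dupNamespace false

noncomputable section

namespace Summit.Langlands.Langlands.Theorems.HilbertIntegralOverconvergentIsCongruence

open MeasureTheory Complex NumberField
open Literature.NumberTheory.Automorphic Literature.NumberTheory.Automorphic.HilbertModular
open scoped MatrixGroups NumberField

/-- **Monomials in Hilbert modular forms and their encodings.** If `enc` is multiplicative on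
Hilbert modular forms of level `Γ₁(𝔫)` (any two weights) and `gf l ∈ M_w(Γ₁(𝔫))` for every `l`, then
for a non-empty multiset `s` the monomial `∏_{l ∈ s} gf l` lies in `M_{(#s) • w}(Γ₁(𝔫))` and
`enc (∏_{l ∈ s} gf l) = ∏_{l ∈ s} enc (gf l)`.  Non-emptiness is needed: the empty product is the
constant `1`, which is not a modular form (forms vanish off `ℍ`). Proof: multiset induction from a
singleton, using `mul_mem_modularForms` (weights add) for the step. [folklore] -/
theorem stub_enc_monomial (F : Type) [Field F] [NumberField F] (𝔫 : Ideal (𝓞 F)) (d : ℕ)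
    (enc : (Point F → ℂ) → MvPowerSeries (Fin d) ℂ)
    (hmul : ∀ (k k' : (F →+* ℝ) → ℤ) (f g : Point F → ℂ), f ∈ modularForms (Bianchi.Gamma1 𝔫) k →
      g ∈ modularForms (Bianchi.Gamma1 𝔫) k' → enc (f * g) = enc f * enc g)
    {ι : Type} (w : (F →+* ℝ) → ℤ) (gf : ι → Point F → ℂ) (hgf : ∀ l, gf l ∈ modularForms (Bianchi.Gamma1 𝔫) w)
    (s : Multiset ι) (hs : s ≠ 0) :
    (s.map gf).prod ∈ modularForms (Bianchi.Gamma1 𝔫) (Multiset.card s • w) ∧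
      enc (s.map gf).prod = (s.map (fun l ↦ enc (gf l))).prod := by
  induction s using Multiset.induction_on with
  | empty => exact absurd rfl hs
  | cons a s ih =>
    by_cases h0 : s = 0
    · subst h0
      refine ⟨?_, ?_⟩
      · simpa only [Multiset.map_cons, Multiset.map_zero, Multiset.prod_cons, Multiset.prod_zero,
          mul_one, Multiset.card_cons, Multiset.card_zero, zero_add, one_nsmul] using hgf a
      · simp only [Multiset.map_cons, Multiset.map_zero, Multiset.prod_cons, Multiset.prod_zero,
          mul_one]
    · obtain ⟨hmem, henc⟩ := ih h0
      have hmem' : gf a * (s.map gf).prod ∈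
          modularForms (Bianchi.Gamma1 𝔫) (Multiset.card (a ::ₘ s) • w) := by
        rw [Multiset.card_cons, succ_nsmul']
        exact mul_mem_modularForms (hgf a) hmem
      refine ⟨by simpa only [Multiset.map_cons, Multiset.prod_cons] using hmem', ?_⟩
      rw [Multiset.map_cons, Multiset.prod_cons, Multiset.map_cons, Multiset.prod_cons,
        hmul w (Multiset.card s • w) (gf a) (s.map gf).prod (hgf a) hmem, henc]

end Summit.Langlands.Langlands.Theorems.HilbertIntegralOverconvergentIsCongruence

end
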